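import Summits.RiemannHypothesis.RiemannHypothesis.Theorems.WeilParityEvenWinsBeyondArchParityCell91
import Summits.RiemannHypothesis.RiemannHypothesis.Theorems.GroundBartaEvenWinsBeyondArchUpper91Sharp
import Summits.RiemannHypothesis.RiemannHypothesis.Theorems.WeilFormatCDataO94OddRung
import Summits.RiemannHypothesis.RiemannHypothesis.Theorems.GroundBartaEvenWinsBeyondArchUpper94Sharp
import Summits.RiemannHypothesis.RiemannHypothesis.Theorems.WeilFormatCDataO97OddRung
import Summits.RiemannHypothesis.RiemannHypothesis.Theorems.GroundBartaEvenWinsBeyondArchUpper9729Sharp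
import Summits.RiemannHypothesis.RiemannHypothesis.Theorems.WeilFormatCDataO100OddRung
import Summits.RiemannHypothesis.RiemannHypothesis.Theorems.WeilGroundStateGroundStateSimpleEvenCellTransfer
import Literature.NumberTheory.LFunctions.WeilGroundEnergyParitySplit
import HarnessLib

/-!
# RiemannHypothesis / GroundBarta — the parity ladder: PARITY CELL 12 `(9729/10000, 1]` CLOSED — the ladder reaches the positivity frontier `a = 1`

Helper file (`--supports stmt-RiemannHypothesis-18085`, `NoParityCrossing`), RH-free.  Prover A (g23 of unit `sr-gb-rung-a`), after
prover B g19's `…ParityCell97` (cells 8–11).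

The ladder step on `[9729/10000, 1]` (`ε`, `ε_od` antitone; `GroundStateSimpleEven.weilWindowSimpleEven_on_cell_of_le`) from three tree facts:
* the ladder up to `91/100` (cells 1–9): `weilWindowSimpleEven_upTo_91` (`…ParityCell91`), and the cell-10/11 steps re-derived inline from
  `trialUpper91sharp` + `WeilFormatCData.O94.weilOddGroundEnergy_94_ge_inv_two_pow_75` and `trialUpper94sharp` +
  `WeilFormatCData.O97.weilOddGroundEnergy_9729_ge_inv_two_pow_81` (= `weilWindowSimpleEven_upTo_94/_9729` of `…ParityCell94/97`, whose hub
  oleans were pending — not imported);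
* the U-side at `9729/10000`: `trialUpper9729sharp : ε(9729/10000) ≤ 9899·10⁻³¹` (`…Upper9729Sharp`: even degree-70 Ritz vector `ne97v1`,
  n = 36, kit j252662; A-layer certificate `ne97v1_T`, killing constant `…MarkovY4` §3 — the last `{2,3,4,5}`-window);
* the L-side at `1`: `WeilFormatCData.O100.weilOddGroundEnergy_one_ge_inv_two_pow_88 : 2⁻⁸⁸ ≤ ε_od(1)`
  (`WeilFormatCDataO100OddRung`, the format-C ODD λ-run at `a = 1` with the FIVE prime powers `2, 3, 4, 5, 7`
  (`WeilFormatC.primeCoeff_form_ge_cells_one_v2`, `A = 2027/1000`), odd block `192`, `μ = 2⁻⁸⁸ = 3.23·10⁻²⁷ > 9899·10⁻³¹`).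
With W-M4 `WeilFormatCData.A1.weilPositivityOn_one` (rh-explicit weil-2) the parity ladder and the positivity ladder now end at the same window.

* `weilWindowSimpleEven_upTo_one` — for every `0 < a ≤ 1` the ground state of the windowed Weil form is simple and even;
* `weilEvenGroundEnergy_lt_weilOddGroundEnergy_upTo_one`, `tailSimpleEven_upTo_one`, `noParityCrossing_upTo_one` — the strict parity order /
  the item-18085 tail shape / the crux `NoParityCrossing` on the certified range `(0, 1]`.

Standard axioms; nothing is defined; no RH claim (a finite-range parity certificate).
-/

set_option linter.dupNamespace false

noncomputable section

open Set MeasureTheory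

namespace Summit.RiemannHypothesis.RiemannHypothesis.Theorems.EvenWinsBeyondArch

open Literature.NumberTheory.LFunctions

/-- **Parity cell 12 closed: the ladder reaches `1`.**  For every window `0 < a ≤ 1` the windowed Weil form has a simple,
even ground state. [folklore] -/
theorem weilWindowSimpleEven_upTo_one : ∀ a : ℝ, 0 < a → a ≤ 1 → WeilWindowSimpleEven a := by
  intro a ha hac
  rcases le_or_gt a (9729 / 10000) with hab | hba
  · -- cells 1–11 (prover B g19's `weilWindowSimpleEven_upTo_9729`, re-derived from built modules only)
    rcases le_or_gt a (47 / 50) with hab10 | hba10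
    · rcases le_or_gt a (91 / 100) with hab9 | hba9
      · exact weilWindowSimpleEven_upTo_91 a ha hab9
      · have hU9 := trialUpper91sharp
        have hL10 := WeilFormatCData.O94.weilOddGroundEnergy_94_ge_inv_two_pow_75
        have hUL9 : (2589 / 100000000000000000000000000 : ℝ) < (1 / 2 ^ 75 : ℝ) := by norm_num
        exact GroundStateSimpleEven.weilWindowSimpleEven_on_cell_of_le (b := 91 / 100) (c := 47 / 50) (by norm_num) hUL9 hU9
          (fun _ hg hs hn ho ↦ hL10.trans (weilOddGroundEnergy_le hg hs ho hn)) hba9.le hab10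
    · have hU10 := trialUpper94sharp
      have hL11 := WeilFormatCData.O97.weilOddGroundEnergy_9729_ge_inv_two_pow_81
      have hUL10 : (2322 / 10000000000000000000000000000 : ℝ) < (1 / 2 ^ 81 : ℝ) := by norm_num
      exact GroundStateSimpleEven.weilWindowSimpleEven_on_cell_of_le (b := 47 / 50) (c := 9729 / 10000) (by norm_num) hUL10 hU10
        (fun _ hg hs hn ho ↦ hL11.trans (weilOddGroundEnergy_le hg hs ho hn)) hba10.le hab
  · have hU := trialUpper9729sharp
    have hL := WeilFormatCData.O100.weilOddGroundEnergy_one_ge_inv_two_pow_88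
    have hUL : (9899 / 10000000000000000000000000000000 : ℝ) < (1 / 2 ^ 88 : ℝ) := by norm_num
    exact GroundStateSimpleEven.weilWindowSimpleEven_on_cell_of_le (b := 9729 / 10000) (c := 1) (by norm_num) hUL hU
      (fun _ hg hs hn ho ↦ hL.trans (weilOddGroundEnergy_le hg hs ho hn)) hba.le hac

/-- The strict parity order `ε_ev(a) < ε_od(a)` for every `0 < a ≤ 1`. [folklore] -/
theorem weilEvenGroundEnergy_lt_weilOddGroundEnergy_upTo_one {a : ℝ} (ha : 0 < a) (hle : a ≤ 1) :
    weilEvenGroundEnergy a < weilOddGroundEnergy a :=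
  (weilWindowSimpleEven_iff_weilEvenGroundEnergy_lt ha).1 (weilWindowSimpleEven_upTo_one a ha hle)

/-- Tail shape of item 18085 up to `1`: simple even ground states on every window `log 2 < a ≤ 1`. [folklore] -/
theorem tailSimpleEven_upTo_one : ∀ a : ℝ, Real.log 2 < a → a ≤ 1 → WeilWindowSimpleEven a :=
  fun a ha hle ↦ weilWindowSimpleEven_upTo_one a ((Real.log_pos (by norm_num)).trans ha) hle

/-- **Item 18085's statement restricted to the certified range**: for every window `(log 3)/2 < a ≤ 1` the even and odd
sector bottoms do not coincide, `ε_ev(a) ≠ ε_od(a)` — the crux `NoParityCrossing` verified on the finite range of the parity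
ladder (cells 1–12). [folklore] -/
theorem noParityCrossing_upTo_one : ∀ a : ℝ, Real.log 3 / 2 < a → a ≤ 1 →
    weilEvenGroundEnergy a ≠ weilOddGroundEnergy a :=
  fun a ha hle ↦ (weilEvenGroundEnergy_lt_weilOddGroundEnergy_upTo_one
    ((div_pos (Real.log_pos (by norm_num)) two_pos).trans ha) hle).ne

end Summit.RiemannHypothesis.RiemannHypothesis.Theorems.EvenWinsBeyondArch

end
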